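import Literature.MathematicalPhysics.QuantumFieldTheory.Balaban1983to89.B1Eq324BenfattoClassCrossRowMassMoment
import Literature.MathematicalPhysics.QuantumFieldTheory.Balaban1983to89.B1Eq324BenfattoConnLength
import HarnessLib

/-!
# `Balaban1983to89.B1Eq324BenfattoClassEntryRows` — [BenfattoEtAl1978] Appendix C (C.1) p. 164 / [Balaban1985BackgroundPropagators] Sect. E
# p. 428 (class form): the DISPLAYED ROWS OF THE CLASS — Euclidean Combes–Thomas row `J_c`, growth rows `V`, `V₂`, `V₄`, absolute rows `M`,
# `M₂` — DISCHARGED from (i) the lattice geometry of `ℤ^d` (uniformly in the volume), (ii) FINITE RANGE + an absolute row-sum bound,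
# (iii) entrywise exponential decay; PROVED, no definition

statement-level skeleton of published theorems with citation tags; proofs where landed; nothing here is a claim about the
Yang–Mills mass gap

WHY THIS MODULE (cell `pub-ymgap`, seat `dag-n08-d` gen 14, CLAIM-68; node N08 [Balaban1985UV3]).  Every theorem of the class road
(`…KernelSect5*`, `…KernelSect5LowerAssembly(Stop)`, `…KernelSect5UpperAssembly`, the class Basic Lemma to come) is stated for a class MEMBER
`(Λ, A)` — a finite `Λ ⊂ ℤ^d` and a symmetric `γ_A`-coercive precision `A` — through six DISPLAYED ROWS in the Euclidean site distance
`|e − e′|₂ = √(Σ_j (e_j − e′_j)²)`: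
`hJc : Σ_{e′}|A e e′|(cosh(θ|e−e′|₂) − 1) ≤ J_c`, `hV : Σ_{e′}e^{−θ|e−e′|₂}(1 + |e−e′|₂) ≤ V`, `hM : Σ_{e′}|A e e′|(1 + |e−e′|₂) ≤ M`,
`hV₂ : Σ_{e′}e^{−(θ/2)|e−e′|₂} ≤ V₂`, `hM₂ : Σ_{e′}|A e e′|e^{(θ/2)|e−e′|₂} ≤ M₂`, `hV₄ : Σ_{e′}e^{−(θ/4)|e−e′|₂}(1 + |e−e′|₂) ≤ V₄`.
No module of the tree supplies them.  This file does, once and for all, with constants explicit and UNIFORM IN `Λ`: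
* the growth rows `V`, `V₂`, `V₄` are pure lattice geometry (`…ConnLength.sum_exp_neg_mul_cubeDist_le` — print's (5.11) one-tessera sum — and
  `cubeDist ≤ |·|₂`, `…ClassCrossRowMassMoment.cubeDist_le_sqrt_sum_sq`);
* the precision rows `J_c`, `M`, `M₂` follow from FINITE RANGE `R` and an absolute row-sum bound `a_row` (the currency of a lattice differential
  operator — the shape in which a fluctuation precision is given) with `J_c(θ) = a_row·(cosh θR − 1) → 0` as `θ → 0`, OR from entrywise
  exponential decay `|A e e′| ≤ K e^{−κ|e−e′|₂}` (the output currency of the covariance-side door `…ClassAppendixC` §6) with `J_c(θ) = O(θ²)`.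
So a consumer holding a finite-range coercive symmetric precision meets ALL class rows by `classRows_of_finiteRange` and picks the rate `θ`
small (`exists_rate_of_finiteRange`) to satisfy `J_c < γ_A`.

WHAT IS PROVED (standard axioms; no `sorry`; no definition; the lattice constant `K_d(c) = (2/(1 − e^{−c/√d})·e^{c/√d})^d` is written inline).
* §1 elementary real inequalities (private plumbing): `one_add_le_mul_exp`, `sq_le_mul_exp`, `cosh_sub_one_le`, `cosh_mul_sub_one_le_mul_exp`.
* §2 growth rows for any finite `Λ ⊂ ℤ^d`, any `θ > 0`: `sum_exp_neg_l2_le`, `sum_exp_neg_l2_mul_one_add_le`; ★★ `classRow_V_le`, `classRow_V₂_le`,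
  `classRow_V₄_le` (the rows' literal shapes).
* §3 finite range: ★★ `classRow_Jc_le_of_finiteRange`, `classRow_M_le_of_finiteRange`, `classRow_M₂_le_of_finiteRange`; `exists_rate_of_finiteRange`.
* §4 entrywise exponential decay: ★★ `classRow_Jc_le_of_abs_le_exp`, `classRow_M_le_of_abs_le_exp`, `classRow_M₂_le_of_abs_le_exp`.
* §5 ★★★ `classRows_of_finiteRange` — the six rows at once, in the order `hJc hV hM hV₂ hM₂ hV₄` of the class theorems.
v1.1 (docstring-only): the three «(1.16)–(1.18) p.180» locators of v1.0 dropped (referee READ367 NIT-1: no such page in CMP 99, 389–434).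
HONEST SCOPE.  [folklore] lattice/matrix bookkeeping for OUR class form; NO statement about [Balaban1985UV3]'s actual fluctuation operator (that its
precision at the pin is symmetric, finite-range and coercive — the identification with N06 [Balaban1985UV2] in-edges — is NOT claimed here);
count-neutral for N08; nothing about d = 4, the continuum, OS axioms, a mass gap or the Clay problem.
-/

noncomputable section

open Finset Matrix
open scoped BigOperators

namespace Literature.MathematicalPhysics.QuantumFieldTheory.Balaban1983to89.B1Eq324BenfattoClassEntryRows

open Literature.MathematicalPhysics.QuantumFieldTheory.Balaban1983to89.B1Eq324BenfattoLemma
open Literature.MathematicalPhysics.QuantumFieldTheory.Balaban1983to89.B1Eq324BenfattoConnLength (sum_exp_neg_mul_cubeDist_le)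
open Literature.MathematicalPhysics.QuantumFieldTheory.Balaban1983to89.B1Eq324BenfattoClassCrossRowMassMoment (cubeDist_le_sqrt_sum_sq)

variable {d : ℕ}

/-! ## §1  Elementary real inequalities -/

/-- `1 + t ≤ (1 + 1/a)·e^{a t}` for `t ≥ 0`, `a > 0` (`a t + 1 ≤ e^{a t}` twice). [folklore] -/
private theorem one_add_le_mul_exp {a t : ℝ} (ha : 0 < a) (ht : 0 ≤ t) : 1 + t ≤ (1 + 1 / a) * Real.exp (a * t) := by
  have h1 : a * t + 1 ≤ Real.exp (a * t) := Real.add_one_le_exp _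
  have h2 : 1 ≤ Real.exp (a * t) := by
    have : 0 ≤ a * t := mul_nonneg ha.le ht
    linarith
  have h3 : t ≤ Real.exp (a * t) / a := by
    rw [le_div_iff₀ ha]
    nlinarith
  calc 1 + t ≤ Real.exp (a * t) + Real.exp (a * t) / a := add_le_add h2 h3
    _ = (1 + 1 / a) * Real.exp (a * t) := by ring

/-- `t² ≤ (4/a²)·e^{a t}` for `t ≥ 0`, `a > 0` (square `a t/2 + 1 ≤ e^{a t/2}`). [folklore] -/
private theorem sq_le_mul_exp {a t : ℝ} (ha : 0 < a) (ht : 0 ≤ t) : t ^ 2 ≤ 4 / a ^ 2 * Real.exp (a * t) := by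
  have h1 : a * t / 2 + 1 ≤ Real.exp (a * t / 2) := Real.add_one_le_exp _
  have h0 : 0 ≤ a * t / 2 := by positivity
  have h2 : (a * t / 2) ^ 2 ≤ Real.exp (a * t / 2) ^ 2 := by
    have : a * t / 2 ≤ Real.exp (a * t / 2) := by linarith
    exact pow_le_pow_left₀ h0 this 2
  have h3 : Real.exp (a * t / 2) ^ 2 = Real.exp (a * t) := by
    rw [sq, ← Real.exp_add]
    ring_nf
  rw [h3] at h2
  rw [div_mul_eq_mul_div, le_div_iff₀ (by positivity)]
  nlinarith

/-- `cosh x − 1 ≤ (x²/2)·eˣ` for `x ≥ 0`: `2(cosh x − 1) = (eˣ − 1)(1 − e^{−x})`, `1 − e^{−x} ≤ x`, `eˣ − 1 ≤ x eˣ`. [folklore] -/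
private theorem cosh_sub_one_le {x : ℝ} (hx : 0 ≤ x) : Real.cosh x - 1 ≤ x ^ 2 / 2 * Real.exp x := by
  have hid : Real.cosh x - 1 = (Real.exp x - 1) * (1 - Real.exp (-x)) / 2 := by
    rw [Real.cosh_eq]
    have : Real.exp x * Real.exp (-x) = 1 := by rw [← Real.exp_add, add_neg_cancel, Real.exp_zero]
    nlinarith
  have h1 : 1 - Real.exp (-x) ≤ x := by linarith [Real.one_sub_le_exp_neg x]
  have h2 : Real.exp x - 1 ≤ x * Real.exp x := by
    have h := Real.one_sub_le_exp_neg x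
    have hmul := mul_le_mul_of_nonneg_left h (Real.exp_pos x).le
    rw [← Real.exp_add, add_neg_cancel, Real.exp_zero] at hmul
    nlinarith
  have h1' : 0 ≤ 1 - Real.exp (-x) := by
    have : Real.exp (-x) ≤ 1 := Real.exp_le_one_iff.mpr (by linarith)
    linarith
  have h2' : 0 ≤ Real.exp x - 1 := by
    have : 1 ≤ Real.exp x := Real.one_le_exp hx
    linarith
  rw [hid]
  have := mul_le_mul h2 h1 h1' (by positivity : 0 ≤ x * Real.exp x)
  nlinarith

/-- `cosh(θt) − 1 ≤ 2(θ/a)²·e^{(θ + a)t}` for `t ≥ 0`, `θ ≥ 0`, `a > 0` (`cosh_sub_one_le` and `sq_le_mul_exp`): the Combes–Thomas weight is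
SMALL OF ORDER `θ²` against any exponential budget. [folklore] -/
private theorem cosh_mul_sub_one_le_mul_exp {θ a t : ℝ} (hθ : 0 ≤ θ) (ha : 0 < a) (ht : 0 ≤ t) :
    Real.cosh (θ * t) - 1 ≤ 2 * (θ / a) ^ 2 * Real.exp ((θ + a) * t) := by
  have h1 := cosh_sub_one_le (mul_nonneg hθ ht : 0 ≤ θ * t)
  have h2 := sq_le_mul_exp ha ht
  have h3 : (θ * t) ^ 2 / 2 * Real.exp (θ * t) ≤ θ ^ 2 * (4 / a ^ 2 * Real.exp (a * t)) / 2 * Real.exp (θ * t) := by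
    have : (θ * t) ^ 2 = θ ^ 2 * t ^ 2 := by ring
    rw [this]
    exact mul_le_mul_of_nonneg_right (div_le_div_of_nonneg_right (mul_le_mul_of_nonneg_left h2 (sq_nonneg θ)) zero_le_two)
      (Real.exp_pos _).le
  refine h1.trans (h3.trans (le_of_eq ?_))
  rw [add_mul, Real.exp_add]
  field_simp
  ring

/-! ## §2  Growth rows: lattice sums over any finite `Λ ⊂ ℤ^d`, uniform in `Λ` -/

/-- **`Σ_{y∈Λ} e^{−θ|x−y|₂} ≤ K_d(θ)`** for `θ > 0`, any finite `Λ`, any anchor `x` (`cubeDist ≤ |·|₂` and print's one-tessera sum (5.11)).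
[cite: BenfattoEtAl1978, (5.11) p.155; Appendix C (C.1) p.164 (class form)] -/
theorem sum_exp_neg_l2_le {θ : ℝ} (hθ : 0 < θ) (Λ : Finset (B1Eq324BenfattoLemma.Site d)) (x : B1Eq324BenfattoLemma.Site d) :
    ∑ y ∈ Λ, Real.exp (-(θ * Real.sqrt (∑ j, (((x j : ℝ) - (y j : ℝ))) ^ 2))) ≤
      (2 / (1 - Real.exp (-(θ / Real.sqrt d))) * Real.exp (θ / Real.sqrt d)) ^ d := by
  refine (Finset.sum_le_sum fun y _ => ?_).trans (sum_exp_neg_mul_cubeDist_le hθ Λ x)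
  exact Real.exp_le_exp.mpr (neg_le_neg (mul_le_mul_of_nonneg_left (cubeDist_le_sqrt_sum_sq x y) hθ.le))

/-- **`Σ_{y∈Λ} e^{−θ|x−y|₂}(1 + |x−y|₂) ≤ (1 + 2/θ)·K_d(θ/2)`** (`one_add_le_mul_exp` at `a = θ/2`, then `sum_exp_neg_l2_le` at `θ/2`).
[cite: BenfattoEtAl1978, (5.11) p.155; Appendix C (C.1) p.164 (class form)] -/
theorem sum_exp_neg_l2_mul_one_add_le {θ : ℝ} (hθ : 0 < θ) (Λ : Finset (B1Eq324BenfattoLemma.Site d)) (x : B1Eq324BenfattoLemma.Site d) :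
    ∑ y ∈ Λ, Real.exp (-(θ * Real.sqrt (∑ j, (((x j : ℝ) - (y j : ℝ))) ^ 2))) * (1 + Real.sqrt (∑ j, (((x j : ℝ) - (y j : ℝ))) ^ 2)) ≤
      (1 + 2 / θ) * (2 / (1 - Real.exp (-(θ / 2 / Real.sqrt d))) * Real.exp (θ / 2 / Real.sqrt d)) ^ d := by
  have hθ2 : 0 < θ / 2 := by positivity
  have hterm : ∀ y ∈ Λ, Real.exp (-(θ * Real.sqrt (∑ j, (((x j : ℝ) - (y j : ℝ))) ^ 2))) * (1 + Real.sqrt (∑ j, (((x j : ℝ) - (y j : ℝ))) ^ 2)) ≤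
      (1 + 2 / θ) * Real.exp (-(θ / 2 * Real.sqrt (∑ j, (((x j : ℝ) - (y j : ℝ))) ^ 2))) := by
    intro y _
    set t := Real.sqrt (∑ j, (((x j : ℝ) - (y j : ℝ))) ^ 2) with ht
    have ht0 : 0 ≤ t := Real.sqrt_nonneg _
    have h := one_add_le_mul_exp hθ2 ht0
    have h12 : (1 + 1 / (θ / 2)) = 1 + 2 / θ := by field_simp
    rw [h12] at h
    calc Real.exp (-(θ * t)) * (1 + t) ≤ Real.exp (-(θ * t)) * ((1 + 2 / θ) * Real.exp (θ / 2 * t)) :=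
          mul_le_mul_of_nonneg_left h (Real.exp_pos _).le
      _ = (1 + 2 / θ) * Real.exp (-(θ / 2 * t)) := by
          rw [mul_left_comm, ← Real.exp_add]
          ring_nf
  refine (Finset.sum_le_sum hterm).trans ?_
  rw [← Finset.mul_sum]
  exact mul_le_mul_of_nonneg_left (sum_exp_neg_l2_le hθ2 Λ x) (by positivity)

section GrowthRows

variable {Λ : Finset (B1Eq324BenfattoLemma.Site d)}

/-- ★★ **THE GROWTH ROW `V`**: `Σ_{e′∈Λ} e^{−θ|e−e′|₂}(1 + |e−e′|₂) ≤ (1 + 2/θ)·K_d(θ/2)` for every `e ∈ Λ` — the row `hV` of the class theorems,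
uniformly in `Λ`. [cite: BenfattoEtAl1978, Appendix C (C.1) p.164; Balaban1985BackgroundPropagators, Sect. E p.428 (class form; ours)] -/
theorem classRow_V_le {θ : ℝ} (hθ : 0 < θ) (e : Λ) :
    ∑ e' : Λ, Real.exp (-(θ * Real.sqrt (∑ j, ((((e : B1Eq324BenfattoLemma.Site d) j : ℝ) - ((e' : B1Eq324BenfattoLemma.Site d) j : ℝ))) ^ 2))) *
        (1 + Real.sqrt (∑ j, ((((e : B1Eq324BenfattoLemma.Site d) j : ℝ) - ((e' : B1Eq324BenfattoLemma.Site d) j : ℝ))) ^ 2)) ≤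
      (1 + 2 / θ) * (2 / (1 - Real.exp (-(θ / 2 / Real.sqrt d))) * Real.exp (θ / 2 / Real.sqrt d)) ^ d := by
  rw [Finset.sum_coe_sort Λ (fun y => Real.exp (-(θ * Real.sqrt (∑ j, ((((e : B1Eq324BenfattoLemma.Site d) j : ℝ) - (y j : ℝ))) ^ 2))) *
    (1 + Real.sqrt (∑ j, ((((e : B1Eq324BenfattoLemma.Site d) j : ℝ) - (y j : ℝ))) ^ 2)))]
  exact sum_exp_neg_l2_mul_one_add_le hθ Λ e

/-- ★★ **THE HALF-RATE GROWTH ROW `V₂`**: `Σ_{e′∈Λ} e^{−(θ/2)|e−e′|₂} ≤ K_d(θ/2)` — the row `hV₂`, uniformly in `Λ`.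
[cite: BenfattoEtAl1978, Appendix C (C.1) p.164; Balaban1985BackgroundPropagators, Sect. E p.428 (class form; ours)] -/
theorem classRow_V₂_le {θ : ℝ} (hθ : 0 < θ) (e : Λ) :
    ∑ e' : Λ, Real.exp (-(θ / 2 * Real.sqrt (∑ j, ((((e : B1Eq324BenfattoLemma.Site d) j : ℝ) - ((e' : B1Eq324BenfattoLemma.Site d) j : ℝ))) ^ 2))) ≤
      (2 / (1 - Real.exp (-(θ / 2 / Real.sqrt d))) * Real.exp (θ / 2 / Real.sqrt d)) ^ d := by
  rw [Finset.sum_coe_sort Λ (fun y => Real.exp (-(θ / 2 * Real.sqrt (∑ j, ((((e : B1Eq324BenfattoLemma.Site d) j : ℝ) - (y j : ℝ))) ^ 2))))]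
  exact sum_exp_neg_l2_le (by positivity) Λ e

/-- ★★ **THE QUARTER-RATE GROWTH ROW `V₄`**: `Σ_{e′∈Λ} e^{−(θ/4)|e−e′|₂}(1 + |e−e′|₂) ≤ (1 + 8/θ)·K_d(θ/8)` — the row `hV₄`, uniformly in `Λ`.
[cite: BenfattoEtAl1978, Appendix C (C.1) p.164; Balaban1985BackgroundPropagators, Sect. E p.428 (class form; ours)] -/
theorem classRow_V₄_le {θ : ℝ} (hθ : 0 < θ) (e : Λ) :
    ∑ e' : Λ, Real.exp (-(θ / 4 * Real.sqrt (∑ j, ((((e : B1Eq324BenfattoLemma.Site d) j : ℝ) - ((e' : B1Eq324BenfattoLemma.Site d) j : ℝ))) ^ 2))) *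
        (1 + Real.sqrt (∑ j, ((((e : B1Eq324BenfattoLemma.Site d) j : ℝ) - ((e' : B1Eq324BenfattoLemma.Site d) j : ℝ))) ^ 2)) ≤
      (1 + 8 / θ) * (2 / (1 - Real.exp (-(θ / 8 / Real.sqrt d))) * Real.exp (θ / 8 / Real.sqrt d)) ^ d := by
  have h := classRow_V_le (θ := θ / 4) (by positivity) e
  have h1 : (1 + 2 / (θ / 4)) = 1 + 8 / θ := by field_simp; ring
  have h2 : θ / 4 / 2 = θ / 8 := by ring
  rw [h1, h2] at h
  exact h

end GrowthRows

/-! ## §3  Precision rows from FINITE RANGE and an absolute row-sum bound -/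

section FiniteRange

variable {Λ : Finset (B1Eq324BenfattoLemma.Site d)} {A : Matrix Λ Λ ℝ} {R arow : ℝ}

/-- The one-line engine: if `A e e′ = 0` beyond Euclidean range `R` and a weight `g` is at most `G ≥ 0` within range, then
`Σ_{e′}|A e e′|·g(e, e′) ≤ a_row·G` for any absolute row-sum bound `a_row` (the mechanism behind every finite-range row of the class).
[cite: BenfattoEtAl1978, Appendix C (C.1) p.164 (class form; ours)] -/
theorem sum_abs_mul_le_of_finiteRange (hR : ∀ e e' : Λ, R < Real.sqrt (∑ j, ((((e : B1Eq324BenfattoLemma.Site d) j : ℝ) - ((e' : B1Eq324BenfattoLemma.Site d) j : ℝ))) ^ 2) → A e e' = 0)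
    (hrow : ∀ e : Λ, ∑ e' : Λ, |A e e'| ≤ arow) (g : Λ → Λ → ℝ) {G : ℝ} (hG : 0 ≤ G)
    (hg : ∀ e e' : Λ, Real.sqrt (∑ j, ((((e : B1Eq324BenfattoLemma.Site d) j : ℝ) - ((e' : B1Eq324BenfattoLemma.Site d) j : ℝ))) ^ 2) ≤ R → g e e' ≤ G)
    (e : Λ) : ∑ e' : Λ, |A e e'| * g e e' ≤ arow * G := by
  have hterm : ∀ e' : Λ, |A e e'| * g e e' ≤ |A e e'| * G := by
    intro e'
    by_cases h : Real.sqrt (∑ j, ((((e : B1Eq324BenfattoLemma.Site d) j : ℝ) - ((e' : B1Eq324BenfattoLemma.Site d) j : ℝ))) ^ 2) ≤ R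
    · exact mul_le_mul_of_nonneg_left (hg e e' h) (abs_nonneg _)
    · rw [hR e e' (lt_of_not_ge h), abs_zero, zero_mul, zero_mul]
  calc ∑ e' : Λ, |A e e'| * g e e' ≤ ∑ e' : Λ, |A e e'| * G := Finset.sum_le_sum fun e' _ => hterm e'
    _ = (∑ e' : Λ, |A e e'|) * G := by rw [Finset.sum_mul]
    _ ≤ arow * G := mul_le_mul_of_nonneg_right (hrow e) hG

/-- ★★ **THE COMBES–THOMAS ROW FROM FINITE RANGE**: `Σ_{e′}|A e e′|(cosh(θ|e−e′|₂) − 1) ≤ a_row·(cosh(θR) − 1)` for a precision of Euclidean range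
`R ≥ 0` with absolute row sums `≤ a_row`, at ANY rate `θ ≥ 0` — the row `hJc` with `J_c(θ) = a_row(cosh θR − 1) → 0` as `θ → 0`.
[cite: BenfattoEtAl1978, Appendix C (C.1)–(C.2) p.164; Balaban1985BackgroundPropagators, Sect. E p.428 (class form; ours)] -/
theorem classRow_Jc_le_of_finiteRange {θ : ℝ} (hθ : 0 ≤ θ) (hR0 : 0 ≤ R)
    (hR : ∀ e e' : Λ, R < Real.sqrt (∑ j, ((((e : B1Eq324BenfattoLemma.Site d) j : ℝ) - ((e' : B1Eq324BenfattoLemma.Site d) j : ℝ))) ^ 2) → A e e' = 0)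
    (hrow : ∀ e : Λ, ∑ e' : Λ, |A e e'| ≤ arow) (e : Λ) :
    ∑ e' : Λ, |A e e'| * (Real.cosh (θ * Real.sqrt (∑ j, ((((e : B1Eq324BenfattoLemma.Site d) j : ℝ) - ((e' : B1Eq324BenfattoLemma.Site d) j : ℝ))) ^ 2)) - 1) ≤
      arow * (Real.cosh (θ * R) - 1) := by
  refine sum_abs_mul_le_of_finiteRange hR hrow
    (fun e e' => Real.cosh (θ * Real.sqrt (∑ j, ((((e : B1Eq324BenfattoLemma.Site d) j : ℝ) - ((e' : B1Eq324BenfattoLemma.Site d) j : ℝ))) ^ 2)) - 1)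
    (by linarith [Real.one_le_cosh (θ * R)]) (fun e e' h => ?_) e
  have hmono : Real.cosh (θ * Real.sqrt (∑ j, ((((e : B1Eq324BenfattoLemma.Site d) j : ℝ) - ((e' : B1Eq324BenfattoLemma.Site d) j : ℝ))) ^ 2)) ≤
      Real.cosh (θ * R) := by
    rw [Real.cosh_le_cosh, abs_of_nonneg (mul_nonneg hθ (Real.sqrt_nonneg _)), abs_of_nonneg (mul_nonneg hθ hR0)]
    exact mul_le_mul_of_nonneg_left h hθ
  linarith

/-- ★★ **THE ABSOLUTE GROWTH ROW FROM FINITE RANGE**: `Σ_{e′}|A e e′|(1 + |e−e′|₂) ≤ a_row·(1 + R)` — the row `hM`.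
[cite: BenfattoEtAl1978, Appendix C (C.1) p.164; Balaban1985BackgroundPropagators, Sect. E p.428 (class form; ours)] -/
theorem classRow_M_le_of_finiteRange (hR0 : 0 ≤ R)
    (hR : ∀ e e' : Λ, R < Real.sqrt (∑ j, ((((e : B1Eq324BenfattoLemma.Site d) j : ℝ) - ((e' : B1Eq324BenfattoLemma.Site d) j : ℝ))) ^ 2) → A e e' = 0)
    (hrow : ∀ e : Λ, ∑ e' : Λ, |A e e'| ≤ arow) (e : Λ) :
    ∑ e' : Λ, |A e e'| * (1 + Real.sqrt (∑ j, ((((e : B1Eq324BenfattoLemma.Site d) j : ℝ) - ((e' : B1Eq324BenfattoLemma.Site d) j : ℝ))) ^ 2)) ≤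
      arow * (1 + R) :=
  sum_abs_mul_le_of_finiteRange hR hrow
    (fun e e' => 1 + Real.sqrt (∑ j, ((((e : B1Eq324BenfattoLemma.Site d) j : ℝ) - ((e' : B1Eq324BenfattoLemma.Site d) j : ℝ))) ^ 2))
    (by linarith) (fun _ _ h => by linarith) e

/-- ★★ **THE HALF-RATE ABSOLUTE ROW FROM FINITE RANGE**: `Σ_{e′}|A e e′|e^{(θ/2)|e−e′|₂} ≤ a_row·e^{(θ/2)R}` (`θ ≥ 0`) — the row `hM₂`.
[cite: BenfattoEtAl1978, Appendix C (C.7) p.164; Balaban1985BackgroundPropagators, Sect. E p.428 (class form; ours)] -/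
theorem classRow_M₂_le_of_finiteRange {θ : ℝ} (hθ : 0 ≤ θ)
    (hR : ∀ e e' : Λ, R < Real.sqrt (∑ j, ((((e : B1Eq324BenfattoLemma.Site d) j : ℝ) - ((e' : B1Eq324BenfattoLemma.Site d) j : ℝ))) ^ 2) → A e e' = 0)
    (hrow : ∀ e : Λ, ∑ e' : Λ, |A e e'| ≤ arow) (e : Λ) :
    ∑ e' : Λ, |A e e'| * Real.exp (θ / 2 * Real.sqrt (∑ j, ((((e : B1Eq324BenfattoLemma.Site d) j : ℝ) - ((e' : B1Eq324BenfattoLemma.Site d) j : ℝ))) ^ 2)) ≤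
      arow * Real.exp (θ / 2 * R) :=
  sum_abs_mul_le_of_finiteRange hR hrow
    (fun e e' => Real.exp (θ / 2 * Real.sqrt (∑ j, ((((e : B1Eq324BenfattoLemma.Site d) j : ℝ) - ((e' : B1Eq324BenfattoLemma.Site d) j : ℝ))) ^ 2)))
    (Real.exp_pos _).le (fun _ _ h => Real.exp_le_exp.mpr (mul_le_mul_of_nonneg_left h (by positivity))) e

omit d in
/-- **A rate exists**: for `γ_A > 0`, `a_row ≥ 0`, `R ≥ 0` there is `θ ∈ (0, 1]` with `a_row·(cosh(θR) − 1) < γ_A` — so the finite-range Combes–Thomas row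
meets the class condition `J_c < γ_A` at a small rate (`cosh_sub_one_le`: `cosh(θR) − 1 ≤ (θR)²e^{θR}/2 ≤ θ·R²e^{R}/2` for `θ ≤ 1`).
[cite: BenfattoEtAl1978, Appendix C (C.1)–(C.2) p.164 «m² − J(κ) > 0» (class form; ours)] -/
theorem exists_rate_of_finiteRange {γA : ℝ} (hγA : 0 < γA) (harow : 0 ≤ arow) (hR0 : 0 ≤ R) :
    ∃ θ : ℝ, 0 < θ ∧ θ ≤ 1 ∧ arow * (Real.cosh (θ * R) - 1) < γA := by
  -- `θ := min 1 (γA / (arow·R²·e^R + γA))` works: `a_row(cosh θR − 1) ≤ a_row·θ²R²e^{θR}/2 ≤ θ·(a_row R² e^R) < γA`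
  set B : ℝ := arow * R ^ 2 * Real.exp R with hB
  have hB0 : 0 ≤ B := by positivity
  refine ⟨min 1 (γA / (B + γA)), lt_min one_pos (div_pos hγA (by positivity)), min_le_left _ _, ?_⟩
  set θ : ℝ := min 1 (γA / (B + γA)) with hθdef
  have hθ0 : 0 < θ := lt_min one_pos (div_pos hγA (by positivity))
  have hθ1 : θ ≤ 1 := min_le_left _ _
  have hθR : 0 ≤ θ * R := mul_nonneg hθ0.le hR0
  have h1 : Real.cosh (θ * R) - 1 ≤ (θ * R) ^ 2 / 2 * Real.exp (θ * R) := cosh_sub_one_le hθR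
  have h2 : Real.exp (θ * R) ≤ Real.exp R := Real.exp_le_exp.mpr (by nlinarith)
  have h3 : (θ * R) ^ 2 / 2 * Real.exp (θ * R) ≤ θ * (R ^ 2 * Real.exp R) := by
    have hθ2 : θ ^ 2 ≤ θ := by nlinarith
    calc (θ * R) ^ 2 / 2 * Real.exp (θ * R) ≤ (θ * R) ^ 2 / 2 * Real.exp R :=
          mul_le_mul_of_nonneg_left h2 (by positivity)
      _ = θ ^ 2 * (R ^ 2 * Real.exp R) / 2 := by ring
      _ ≤ θ * (R ^ 2 * Real.exp R) / 2 := by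
          exact div_le_div_of_nonneg_right (mul_le_mul_of_nonneg_right hθ2 (by positivity)) zero_le_two
      _ ≤ θ * (R ^ 2 * Real.exp R) := by
          have : 0 ≤ θ * (R ^ 2 * Real.exp R) := by positivity
          linarith
  have h4 : arow * (Real.cosh (θ * R) - 1) ≤ θ * B := by
    calc arow * (Real.cosh (θ * R) - 1) ≤ arow * (θ * (R ^ 2 * Real.exp R)) := mul_le_mul_of_nonneg_left (h1.trans h3) harow
      _ = θ * B := by rw [hB]; ring
  have h5 : θ * B < γA := by
    have hθle : θ ≤ γA / (B + γA) := min_le_right _ _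
    have hBγ : 0 < B + γA := by positivity
    calc θ * B ≤ γA / (B + γA) * B := mul_le_mul_of_nonneg_right hθle hB0
      _ < γA := by
          rw [div_mul_eq_mul_div, div_lt_iff₀ hBγ]
          nlinarith
  exact h4.trans_lt h5

end FiniteRange

/-! ## §4  Precision rows from ENTRYWISE EXPONENTIAL DECAY (the covariance door's currency) -/

section Decay

variable {Λ : Finset (B1Eq324BenfattoLemma.Site d)} {A : Matrix Λ Λ ℝ} {K κ : ℝ}

/-- ★★ **THE HALF-RATE ABSOLUTE ROW FROM DECAY**: `|A e e′| ≤ K e^{−κ|e−e′|₂}` (`κ > 0`, `K ≥ 0`) and `θ ≤ κ` give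
`Σ_{e′}|A e e′|e^{(θ/2)|e−e′|₂} ≤ K·K_d(κ/2)` — the row `hM₂`. [cite: BenfattoEtAl1978, Appendix C (C.2), (C.7) p.164 (class form; ours)] -/
theorem classRow_M₂_le_of_abs_le_exp (hK : 0 ≤ K) (hκ : 0 < κ) {θ : ℝ} (hθκ : θ ≤ κ)
    (hA : ∀ e e' : Λ, |A e e'| ≤ K * Real.exp (-(κ * Real.sqrt (∑ j, ((((e : B1Eq324BenfattoLemma.Site d) j : ℝ) - ((e' : B1Eq324BenfattoLemma.Site d) j : ℝ))) ^ 2))))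
    (e : Λ) :
    ∑ e' : Λ, |A e e'| * Real.exp (θ / 2 * Real.sqrt (∑ j, ((((e : B1Eq324BenfattoLemma.Site d) j : ℝ) - ((e' : B1Eq324BenfattoLemma.Site d) j : ℝ))) ^ 2)) ≤
      K * (2 / (1 - Real.exp (-(κ / 2 / Real.sqrt d))) * Real.exp (κ / 2 / Real.sqrt d)) ^ d := by
  have hterm : ∀ e' : Λ, |A e e'| * Real.exp (θ / 2 * Real.sqrt (∑ j, ((((e : B1Eq324BenfattoLemma.Site d) j : ℝ) - ((e' : B1Eq324BenfattoLemma.Site d) j : ℝ))) ^ 2)) ≤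
      K * Real.exp (-(κ / 2 * Real.sqrt (∑ j, ((((e : B1Eq324BenfattoLemma.Site d) j : ℝ) - ((e' : B1Eq324BenfattoLemma.Site d) j : ℝ))) ^ 2))) := by
    intro e'
    set t := Real.sqrt (∑ j, ((((e : B1Eq324BenfattoLemma.Site d) j : ℝ) - ((e' : B1Eq324BenfattoLemma.Site d) j : ℝ))) ^ 2) with ht
    have ht0 : 0 ≤ t := Real.sqrt_nonneg _
    calc |A e e'| * Real.exp (θ / 2 * t) ≤ K * Real.exp (-(κ * t)) * Real.exp (θ / 2 * t) :=
          mul_le_mul_of_nonneg_right (hA e e') (Real.exp_pos _).le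
      _ = K * Real.exp (-(κ * t) + θ / 2 * t) := by rw [mul_assoc, ← Real.exp_add]
      _ ≤ K * Real.exp (-(κ / 2 * t)) := mul_le_mul_of_nonneg_left (Real.exp_le_exp.mpr (by nlinarith)) hK
  refine (Finset.sum_le_sum fun e' _ => hterm e').trans ?_
  rw [← Finset.mul_sum]
  refine mul_le_mul_of_nonneg_left ?_ hK
  rw [Finset.sum_coe_sort Λ (fun y => Real.exp (-(κ / 2 * Real.sqrt (∑ j, ((((e : B1Eq324BenfattoLemma.Site d) j : ℝ) - (y j : ℝ))) ^ 2))))]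
  exact sum_exp_neg_l2_le (by positivity) Λ e

/-- ★★ **THE ABSOLUTE GROWTH ROW FROM DECAY**: `Σ_{e′}|A e e′|(1 + |e−e′|₂) ≤ K·(1 + 2/κ)·K_d(κ/2)` — the row `hM`.
[cite: BenfattoEtAl1978, Appendix C (C.1)–(C.2) p.164 (class form; ours)] -/
theorem classRow_M_le_of_abs_le_exp (hK : 0 ≤ K) (hκ : 0 < κ)
    (hA : ∀ e e' : Λ, |A e e'| ≤ K * Real.exp (-(κ * Real.sqrt (∑ j, ((((e : B1Eq324BenfattoLemma.Site d) j : ℝ) - ((e' : B1Eq324BenfattoLemma.Site d) j : ℝ))) ^ 2))))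
    (e : Λ) :
    ∑ e' : Λ, |A e e'| * (1 + Real.sqrt (∑ j, ((((e : B1Eq324BenfattoLemma.Site d) j : ℝ) - ((e' : B1Eq324BenfattoLemma.Site d) j : ℝ))) ^ 2)) ≤
      K * ((1 + 2 / κ) * (2 / (1 - Real.exp (-(κ / 2 / Real.sqrt d))) * Real.exp (κ / 2 / Real.sqrt d)) ^ d) := by
  have hterm : ∀ e' : Λ, |A e e'| * (1 + Real.sqrt (∑ j, ((((e : B1Eq324BenfattoLemma.Site d) j : ℝ) - ((e' : B1Eq324BenfattoLemma.Site d) j : ℝ))) ^ 2)) ≤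
      K * (Real.exp (-(κ * Real.sqrt (∑ j, ((((e : B1Eq324BenfattoLemma.Site d) j : ℝ) - ((e' : B1Eq324BenfattoLemma.Site d) j : ℝ))) ^ 2))) *
        (1 + Real.sqrt (∑ j, ((((e : B1Eq324BenfattoLemma.Site d) j : ℝ) - ((e' : B1Eq324BenfattoLemma.Site d) j : ℝ))) ^ 2))) := by
    intro e'
    rw [← mul_assoc]
    exact mul_le_mul_of_nonneg_right (hA e e') (by positivity)
  refine (Finset.sum_le_sum fun e' _ => hterm e').trans ?_
  rw [← Finset.mul_sum]
  refine mul_le_mul_of_nonneg_left ?_ hK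
  rw [Finset.sum_coe_sort Λ (fun y => Real.exp (-(κ * Real.sqrt (∑ j, ((((e : B1Eq324BenfattoLemma.Site d) j : ℝ) - (y j : ℝ))) ^ 2))) *
    (1 + Real.sqrt (∑ j, ((((e : B1Eq324BenfattoLemma.Site d) j : ℝ) - (y j : ℝ))) ^ 2)))]
  exact sum_exp_neg_l2_mul_one_add_le hκ Λ e

/-- ★★ **THE COMBES–THOMAS ROW FROM DECAY, SMALL OF ORDER `θ²`**: `|A e e′| ≤ K e^{−κ|e−e′|₂}` and `0 ≤ θ ≤ κ/4` give
`Σ_{e′}|A e e′|(cosh(θ|e−e′|₂) − 1) ≤ K·(32θ²/κ²)·K_d(κ/2)` — the row `hJc` with `J_c(θ) → 0` as `θ → 0` (`cosh_mul_sub_one_le_mul_exp` at `a = κ/4`).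
[cite: BenfattoEtAl1978, Appendix C (C.1)–(C.2) p.164; Balaban1985BackgroundPropagators, Sect. E p.428 (class form; ours)] -/
theorem classRow_Jc_le_of_abs_le_exp (hK : 0 ≤ K) (hκ : 0 < κ) {θ : ℝ} (hθ : 0 ≤ θ) (hθκ : θ ≤ κ / 4)
    (hA : ∀ e e' : Λ, |A e e'| ≤ K * Real.exp (-(κ * Real.sqrt (∑ j, ((((e : B1Eq324BenfattoLemma.Site d) j : ℝ) - ((e' : B1Eq324BenfattoLemma.Site d) j : ℝ))) ^ 2))))
    (e : Λ) :
    ∑ e' : Λ, |A e e'| * (Real.cosh (θ * Real.sqrt (∑ j, ((((e : B1Eq324BenfattoLemma.Site d) j : ℝ) - ((e' : B1Eq324BenfattoLemma.Site d) j : ℝ))) ^ 2)) - 1) ≤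
      K * (32 * θ ^ 2 / κ ^ 2) * (2 / (1 - Real.exp (-(κ / 2 / Real.sqrt d))) * Real.exp (κ / 2 / Real.sqrt d)) ^ d := by
  have hκ4 : 0 < κ / 4 := by positivity
  have hterm : ∀ e' : Λ, |A e e'| * (Real.cosh (θ * Real.sqrt (∑ j, ((((e : B1Eq324BenfattoLemma.Site d) j : ℝ) - ((e' : B1Eq324BenfattoLemma.Site d) j : ℝ))) ^ 2)) - 1) ≤
      K * (32 * θ ^ 2 / κ ^ 2) * Real.exp (-(κ / 2 * Real.sqrt (∑ j, ((((e : B1Eq324BenfattoLemma.Site d) j : ℝ) - ((e' : B1Eq324BenfattoLemma.Site d) j : ℝ))) ^ 2))) := by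
    intro e'
    set t := Real.sqrt (∑ j, ((((e : B1Eq324BenfattoLemma.Site d) j : ℝ) - ((e' : B1Eq324BenfattoLemma.Site d) j : ℝ))) ^ 2) with ht
    have ht0 : 0 ≤ t := Real.sqrt_nonneg _
    have hc := cosh_mul_sub_one_le_mul_exp hθ hκ4 ht0
    have hc0 : 0 ≤ Real.cosh (θ * t) - 1 := by linarith [Real.one_le_cosh (θ * t)]
    have h32 : 2 * (θ / (κ / 4)) ^ 2 = 32 * θ ^ 2 / κ ^ 2 := by field_simp; ring
    rw [h32] at hc
    calc |A e e'| * (Real.cosh (θ * t) - 1) ≤ K * Real.exp (-(κ * t)) * (32 * θ ^ 2 / κ ^ 2 * Real.exp ((θ + κ / 4) * t)) :=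
          mul_le_mul (hA e e') hc hc0 (by positivity)
      _ = K * (32 * θ ^ 2 / κ ^ 2) * Real.exp (-(κ * t) + (θ + κ / 4) * t) := by rw [Real.exp_add]; ring
      _ ≤ K * (32 * θ ^ 2 / κ ^ 2) * Real.exp (-(κ / 2 * t)) :=
          mul_le_mul_of_nonneg_left (Real.exp_le_exp.mpr (by nlinarith)) (by positivity)
  refine (Finset.sum_le_sum fun e' _ => hterm e').trans ?_
  rw [← Finset.mul_sum]
  refine mul_le_mul_of_nonneg_left ?_ (by positivity)
  rw [Finset.sum_coe_sort Λ (fun y => Real.exp (-(κ / 2 * Real.sqrt (∑ j, ((((e : B1Eq324BenfattoLemma.Site d) j : ℝ) - (y j : ℝ))) ^ 2))))]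
  exact sum_exp_neg_l2_le (by positivity) Λ e

end Decay

/-! ## §5  The package: a finite-range precision with bounded absolute row sums meets every displayed class row -/

section Package

variable {Λ : Finset (B1Eq324BenfattoLemma.Site d)} {A : Matrix Λ Λ ℝ} {R arow : ℝ}

/-- ★★★ **CLASS ENTRY FOR A FINITE-RANGE PRECISION.**  Let `A` be a precision on a finite `Λ ⊂ ℤ^d` of Euclidean range `R ≥ 0` (`A e e′ = 0` for
`|e−e′|₂ > R`) with absolute row sums `≤ a_row`.  Then at EVERY rate `θ > 0` the six displayed rows of the class theorems
(`…KernelSect5LowerAssembly.exp_cumulantSum_sub_le_integral_of_ledger` & co., in their order `hJc hV hM hV₂ hM₂ hV₄`) hold with the constants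
`J_c = a_row(cosh θR − 1)`, `V = (1 + 2/θ)K_d(θ/2)`, `M = a_row(1 + R)`, `V₂ = K_d(θ/2)`, `M₂ = a_row e^{θR/2}`, `V₄ = (1 + 8/θ)K_d(θ/8)`,
`K_d(c) = (2/(1 − e^{−c/√d})·e^{c/√d})^d` — UNIFORMLY IN `Λ`.  Coercivity `γ_A` and symmetry are the member's own; the conditions `J_c < γ_A` and the
corridor guard are then met by taking `θ` small (`exists_rate_of_finiteRange`) and the corridor wide.
[cite: BenfattoEtAl1978, Appendix C (C.1)–(C.2) p.164; Balaban1985BackgroundPropagators, Sect. E p.428 (class form; ours)] -/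
theorem classRows_of_finiteRange {θ : ℝ} (hθ : 0 < θ) (hR0 : 0 ≤ R)
    (hR : ∀ e e' : Λ, R < Real.sqrt (∑ j, ((((e : B1Eq324BenfattoLemma.Site d) j : ℝ) - ((e' : B1Eq324BenfattoLemma.Site d) j : ℝ))) ^ 2) → A e e' = 0)
    (hrow : ∀ e : Λ, ∑ e' : Λ, |A e e'| ≤ arow) :
    (∀ e : Λ, ∑ e' : Λ, |A e e'| * (Real.cosh (θ * Real.sqrt (∑ j, ((((e : B1Eq324BenfattoLemma.Site d) j : ℝ) - ((e' : B1Eq324BenfattoLemma.Site d) j : ℝ))) ^ 2)) - 1) ≤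
        arow * (Real.cosh (θ * R) - 1)) ∧
    (∀ e : Λ, ∑ e' : Λ, Real.exp (-(θ * Real.sqrt (∑ j, ((((e : B1Eq324BenfattoLemma.Site d) j : ℝ) - ((e' : B1Eq324BenfattoLemma.Site d) j : ℝ))) ^ 2))) *
        (1 + Real.sqrt (∑ j, ((((e : B1Eq324BenfattoLemma.Site d) j : ℝ) - ((e' : B1Eq324BenfattoLemma.Site d) j : ℝ))) ^ 2)) ≤
        (1 + 2 / θ) * (2 / (1 - Real.exp (-(θ / 2 / Real.sqrt d))) * Real.exp (θ / 2 / Real.sqrt d)) ^ d) ∧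
    (∀ e : Λ, ∑ e' : Λ, |A e e'| * (1 + Real.sqrt (∑ j, ((((e : B1Eq324BenfattoLemma.Site d) j : ℝ) - ((e' : B1Eq324BenfattoLemma.Site d) j : ℝ))) ^ 2)) ≤
        arow * (1 + R)) ∧
    (∀ e : Λ, ∑ e' : Λ, Real.exp (-(θ / 2 * Real.sqrt (∑ j, ((((e : B1Eq324BenfattoLemma.Site d) j : ℝ) - ((e' : B1Eq324BenfattoLemma.Site d) j : ℝ))) ^ 2))) ≤
        (2 / (1 - Real.exp (-(θ / 2 / Real.sqrt d))) * Real.exp (θ / 2 / Real.sqrt d)) ^ d) ∧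
    (∀ e : Λ, ∑ e' : Λ, |A e e'| * Real.exp (θ / 2 * Real.sqrt (∑ j, ((((e : B1Eq324BenfattoLemma.Site d) j : ℝ) - ((e' : B1Eq324BenfattoLemma.Site d) j : ℝ))) ^ 2)) ≤
        arow * Real.exp (θ / 2 * R)) ∧
    (∀ e : Λ, ∑ e' : Λ, Real.exp (-(θ / 4 * Real.sqrt (∑ j, ((((e : B1Eq324BenfattoLemma.Site d) j : ℝ) - ((e' : B1Eq324BenfattoLemma.Site d) j : ℝ))) ^ 2))) *
        (1 + Real.sqrt (∑ j, ((((e : B1Eq324BenfattoLemma.Site d) j : ℝ) - ((e' : B1Eq324BenfattoLemma.Site d) j : ℝ))) ^ 2)) ≤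
        (1 + 8 / θ) * (2 / (1 - Real.exp (-(θ / 8 / Real.sqrt d))) * Real.exp (θ / 8 / Real.sqrt d)) ^ d) :=
  ⟨classRow_Jc_le_of_finiteRange hθ.le hR0 hR hrow, classRow_V_le hθ, classRow_M_le_of_finiteRange hR0 hR hrow, classRow_V₂_le hθ,
    classRow_M₂_le_of_finiteRange hθ.le hR hrow, classRow_V₄_le hθ⟩

end Package

end Literature.MathematicalPhysics.QuantumFieldTheory.Balaban1983to89.B1Eq324BenfattoClassEntryRows

end
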